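import Mathlib

/-!
# `BalabanUV.Beta.GAN24.DirichletBoxWindowPoly` — binder row G-an2-4 / (CONV-C), road P2 PART II, module M-W: THE WINDOW POLYNOMIAL
# of the two-level pairing (pure polynomial algebra; unit b2b-balaban-gan24-p2, gen 22, v1)

HONEST FRAMING (cell contract, verbatim): «discharging `BetaPertH` makes Bałaban's UV stability UNCONDITIONAL — a real constructive-QFT
result; it is NOT the continuum limit and NOT the Clay problem.»  Road P2 PART II supplies, under the T⁴-DAG sub-row
`T4-U1a.S-NE2-D1-DIRICHLET°` (holder: the t4-ne2-p1 lineage, wall `hinj`), a kernel proof of the two-level INJECTED LAW of the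
`Ω`-compressed `U = 1` scalar free tower ([Balaban1985BackgroundPropagators] (3.24) p. 394 at `U = 1`, Dirichlet conditions
«Δ′_a↾Ω₀ = Ω₀Δ′_aΩ₀») for corner-free (box) regions — memo `HOME/b2b-balaban-gan24-p2/gen22/DIRICHLET-BOX-TWOLEVEL.md`.  Its analytic
heart (module M-P, step L2 of the memo) is the identity `J·Δ_k − Δ_{k+1}·J = Σ_μ (A_μ − F_μ)ᴴ∂_μ` with `A_μ − F_μ = N√(R^d)·Q₀N⁰_μ·p_R(S′_μ)`,
where `S′_μ` is the fine translation and
`p_R(X) = (Σ_{s<R} X^s)(X^R − 1) − R²X^{R−1}(X − 1)` — the generating polynomial of «block difference of cell sums minus `R²` times the face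
difference».  THIS FILE is the polynomial algebra of `p_R`, nothing else: `p_R = (X − 1)²·W_R` with an EXPLICITLY BOUNDED quotient
(`‖coeff_n W_R‖ ≤ R²`, `coeff_n W_R = 0` for `n ≥ 2R − 2`), i.e. the pairing sees only SECOND differences, through a window of `2R − 2`
sites with weights `≤ R²`.  Pure Mathlib (`Polynomial.divByMonic`, `coeff_divByMonic_X_sub_C`); [folklore].

## What this file proves (0 sorry)
* §1 `sig R = Σ_{s<R} X^s`, `qpoly R = sig² − R²X^{R−1}`, `ppoly R = sig·(X^R − 1) − R²X^{R−1}(X − 1) = (X − 1)·qpoly R`, `qpoly R` has the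
  root `1` (`Σ_{s<R}1 = R`), `wpoly R := qpoly R /ₘ (X − 1)`, **`ppoly_eq`**: `ppoly R = (X − 1)²·wpoly R`.
* §2 coefficients: `coeff (sig²) = pair counts`, `Σ_{i∈S} coeff_i(sig²) = #{(a,b) ∈ [0,R)² : a + b ∈ S} ∈ [0, R²]`;
  `natDegree (qpoly R) ≤ 2R − 2`; **`norm_coeff_wpoly_le`**: `‖coeff_n (wpoly R)‖ ≤ R²`; **`coeff_wpoly_eq_zero`**: `coeff_n (wpoly R) = 0`
  for `2R − 2 ≤ n`; **`wpoly_eq_sum`**: `wpoly R = Σ_{n<2R−2} C(coeff_n) X^n`.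

NOT CLAIMED: anything beyond polynomial algebra.  HONEST DEPENDENCY: continuum YM on T⁴ ⇐ BetaPertH ∧ nine spine estimates (0/9 proved);
BetaPertH ⇐ (D1) ∧ (D4) ∧ CAP+tail; G-an2-4 gates asym, D1 and NE2/3/4.
-/

noncomputable section

open scoped BigOperators
open Finset Polynomial

namespace Summit.QuantumFields.BalabanUV.Beta.GAN24.DirichletBoxWindowPoly

/-! ## §1 The polynomials and the factorisation `p_R = (X − 1)²·W_R` -/

/-- `σ_R = Σ_{s<R} X^s` (generating polynomial of a cell's `R` sites along one direction). [folklore] -/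
def sig (R : ℕ) : ℂ[X] := ∑ s ∈ range R, X ^ s

/-- `q_R = σ_R² − R²·X^{R−1}`. [folklore] -/
def qpoly (R : ℕ) : ℂ[X] := sig R ^ 2 - C ((R : ℂ) ^ 2) * X ^ (R - 1)

/-- `p_R = σ_R·(X^R − 1) − R²·X^{R−1}·(X − 1)`: «block difference of the cell sums minus `R²` times the face difference». [folklore] -/
def ppoly (R : ℕ) : ℂ[X] := sig R * (X ^ R - 1) - C ((R : ℂ) ^ 2) * X ^ (R - 1) * (X - 1)

/-- the window polynomial `W_R = q_R / (X − 1)`. [folklore] -/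
def wpoly (R : ℕ) : ℂ[X] := qpoly R /ₘ (X - C 1)

/-- `σ_R·(X − 1) = X^R − 1`. [folklore] -/
theorem sig_mul_X_sub_one (R : ℕ) : sig R * (X - 1) = X ^ R - 1 := geom_sum_mul X R

/-- `p_R = (X − 1)·q_R`. [folklore] -/
theorem ppoly_eq_mul_qpoly (R : ℕ) : ppoly R = (X - 1) * qpoly R := by
  rw [ppoly, qpoly, ← sig_mul_X_sub_one]; ring

/-- `σ_R(1) = R`. [folklore] -/
theorem eval_one_sig (R : ℕ) : (sig R).eval 1 = R := by
  simp [sig, eval_finsetSum]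

/-- `q_R(1) = 0`. [folklore] -/
theorem isRoot_qpoly_one (R : ℕ) : (qpoly R).IsRoot 1 := by
  simp [IsRoot, qpoly, eval_one_sig]

/-- `q_R = (X − 1)·W_R`. [folklore] -/
theorem qpoly_eq_mul_wpoly (R : ℕ) : qpoly R = (X - 1) * wpoly R := by
  have h := (mul_divByMonic_eq_iff_isRoot (p := qpoly R) (a := (1 : ℂ))).mpr (isRoot_qpoly_one R)
  rw [map_one] at h
  exact h.symm

/-- **`p_R = (X − 1)²·W_R`.** [folklore] -/
theorem ppoly_eq (R : ℕ) : ppoly R = (X - 1) ^ 2 * wpoly R := by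
  rw [ppoly_eq_mul_qpoly, qpoly_eq_mul_wpoly, pow_two, mul_assoc]

/-! ## §2 Coefficients: the quotient has a window of `2R − 2` coefficients, each of size `≤ R²` -/

/-- `σ_R² = Σ_{a<R} Σ_{b<R} X^{a+b}`. [folklore] -/
theorem sig_sq_eq (R : ℕ) : sig R ^ 2 = ∑ a ∈ range R, ∑ b ∈ range R, X ^ (a + b) := by
  rw [pow_two, sig, Finset.sum_mul_sum]
  refine Finset.sum_congr rfl fun a _ => Finset.sum_congr rfl fun b _ => ?_
  rw [pow_add]

/-- the coefficients of `σ_R²` are pair counts: `coeff_i(σ_R²) = Σ_{a,b<R} [a + b = i]`. [folklore] -/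
theorem coeff_sig_sq (R i : ℕ) :
    (sig R ^ 2).coeff i = ∑ a ∈ range R, ∑ b ∈ range R, (if i = a + b then (1 : ℂ) else 0) := by
  rw [sig_sq_eq, finsetSum_coeff]
  refine Finset.sum_congr rfl fun a _ => ?_
  rw [finsetSum_coeff]
  refine Finset.sum_congr rfl fun b _ => ?_
  rw [coeff_X_pow]

/-- the pair count `#{(a,b) ∈ [0,R)² : a + b ∈ S}`. [folklore] -/
def cnt (R : ℕ) (S : Finset ℕ) : ℕ := ((range R ×ˢ range R).filter fun p => p.1 + p.2 ∈ S).card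

/-- `Σ_{i∈S} coeff_i(σ_R²) = cnt R S`. [folklore] -/
theorem sum_coeff_sig_sq (R : ℕ) (S : Finset ℕ) : ∑ i ∈ S, (sig R ^ 2).coeff i = (cnt R S : ℂ) := by
  simp_rw [coeff_sig_sq]
  rw [Finset.sum_comm]
  simp_rw [Finset.sum_comm (s := S) (t := range R)]
  rw [cnt, Finset.card_filter, Nat.cast_sum, Finset.sum_product]
  refine Finset.sum_congr rfl fun a _ => Finset.sum_congr rfl fun b _ => ?_
  rw [Finset.sum_ite_eq' S (a + b)]
  push_cast
  rfl

/-- `cnt R S ≤ R²`. [folklore] -/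
theorem cnt_le (R : ℕ) (S : Finset ℕ) : cnt R S ≤ R ^ 2 := by
  calc cnt R S ≤ (range R ×ˢ range R).card := Finset.card_filter_le _ _
    _ = R ^ 2 := by rw [Finset.card_product, Finset.card_range, pow_two]

/-- coefficients of `q_R`. [folklore] -/
theorem coeff_qpoly (R i : ℕ) :
    (qpoly R).coeff i = (sig R ^ 2).coeff i - (if i = R - 1 then ((R : ℂ) ^ 2) else 0) := by
  rw [qpoly, coeff_sub, coeff_C_mul, coeff_X_pow, mul_ite, mul_one, mul_zero]

/-- `Σ_{i∈S} coeff_i(q_R) = cnt R S − R²·[R−1 ∈ S]`. [folklore] -/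
theorem sum_coeff_qpoly (R : ℕ) (S : Finset ℕ) :
    ∑ i ∈ S, (qpoly R).coeff i = (cnt R S : ℂ) - (if R - 1 ∈ S then ((R : ℂ) ^ 2) else 0) := by
  simp_rw [coeff_qpoly, Finset.sum_sub_distrib, sum_coeff_sig_sq, Finset.sum_ite_eq']

/-- `‖Σ_{i∈S} coeff_i(q_R)‖ ≤ R²`. [folklore] -/
theorem norm_sum_coeff_qpoly_le (R : ℕ) (S : Finset ℕ) : ‖∑ i ∈ S, (qpoly R).coeff i‖ ≤ (R : ℝ) ^ 2 := by
  rw [sum_coeff_qpoly]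
  have h0 : (0 : ℝ) ≤ cnt R S := Nat.cast_nonneg _
  have h1 : (cnt R S : ℝ) ≤ (R : ℝ) ^ 2 := by exact_mod_cast cnt_le R S
  split_ifs
  · have e : ((cnt R S : ℂ) - (R : ℂ) ^ 2) = (((cnt R S : ℝ) - (R : ℝ) ^ 2 : ℝ) : ℂ) := by push_cast; ring
    rw [e, Complex.norm_real, Real.norm_eq_abs, abs_le]
    constructor <;> linarith
  · rw [sub_zero, Complex.norm_natCast]
    exact h1

/-- `natDegree σ_R ≤ R − 1`. [folklore] -/
theorem natDegree_sig_le (R : ℕ) : (sig R).natDegree ≤ R - 1 := by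
  rw [sig]
  refine natDegree_sum_le_of_forall_le _ _ (fun s hs => ?_)
  have := Finset.mem_range.mp hs
  exact (natDegree_X_pow_le s).trans (by omega)

/-- `natDegree q_R ≤ 2R − 2`. [folklore] -/
theorem natDegree_qpoly_le (R : ℕ) : (qpoly R).natDegree ≤ 2 * R - 2 := by
  rw [qpoly]
  refine (natDegree_sub_le _ _).trans (max_le ?_ ?_)
  · refine natDegree_pow_le.trans ?_
    have := natDegree_sig_le R
    omega
  · refine (natDegree_C_mul_le _ _).trans ((natDegree_X_pow_le _).trans (by omega))

/-- the coefficients of the quotient: `coeff_n(W_R) = Σ_{i ∈ [n+1, deg q_R]} coeff_i(q_R)`. [folklore] -/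
theorem coeff_wpoly (R n : ℕ) : (wpoly R).coeff n = ∑ i ∈ Icc (n + 1) (qpoly R).natDegree, (qpoly R).coeff i := by
  rw [wpoly, coeff_divByMonic_X_sub_C]
  refine Finset.sum_congr rfl fun i _ => ?_
  rw [one_pow, one_mul]

/-- **`‖coeff_n(W_R)‖ ≤ R²`.** [folklore] -/
theorem norm_coeff_wpoly_le (R n : ℕ) : ‖(wpoly R).coeff n‖ ≤ (R : ℝ) ^ 2 := by
  rw [coeff_wpoly]
  exact norm_sum_coeff_qpoly_le R _

/-- **`coeff_n(W_R) = 0` for `n ≥ 2R − 2`** (the window has `2R − 2` sites). [folklore] -/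
theorem coeff_wpoly_eq_zero (R : ℕ) {n : ℕ} (hn : 2 * R - 2 ≤ n) : (wpoly R).coeff n = 0 := by
  rw [coeff_wpoly]
  refine Finset.sum_eq_zero fun i hi => ?_
  exfalso
  have h1 := (Finset.mem_Icc.mp hi).1
  have h2 := (Finset.mem_Icc.mp hi).2
  have := natDegree_qpoly_le R
  omega

/-- `natDegree W_R < 2R − 2` unless `W_R = 0`; in all cases `W_R = Σ_{n<2R−2} C(coeff_n)·X^n`. [folklore] -/
theorem wpoly_eq_sum (R : ℕ) : wpoly R = ∑ n ∈ range (2 * R - 2), C ((wpoly R).coeff n) * X ^ n := by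
  by_cases h0 : wpoly R = 0
  · rw [h0]
    simp
  · have hdeg : (wpoly R).natDegree < 2 * R - 2 := by
      by_contra hge
      push Not at hge
      have hz := coeff_wpoly_eq_zero R hge
      exact (leadingCoeff_ne_zero.mpr h0) hz
    conv_lhs => rw [as_sum_range' (wpoly R) (2 * R - 2) hdeg]
    refine Finset.sum_congr rfl fun n _ => ?_
    rw [← C_mul_X_pow_eq_monomial]

end Summit.QuantumFields.BalabanUV.Beta.GAN24.DirichletBoxWindowPoly

end
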